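import Summits.QuantumFields.YangMills.Theorems.UnitScaleTiltFluctuationComparisonRegPrGlobalSlackKernelEndToEnd
import HarnessLib

/-!
# `UnitScaleTiltFluctuationComparisonRegPrGlobalSlackKernelRescale` — THE COLLAR POLYLOGARITHM OF (28) IS PAID BY THE KERNEL'S BIRTH COUPLING, I: scalars, couplings,
# dilations, the honest rows and the rescaled chart pair (crux `FluctuationComparisonRegPrL`, stmt-QuantumFields-19935, STUB 3⁗ `stub_globalTwoRunSlackFam`; lane A)

PORT (prover seat ym-ust-19935-slack g0) of ym-cruxidea-19201-1 g14's crux sketch `Cruxes/FluctuationComparisonRegPr/Sketch_ideator1_g14.lean` (sha16 196e545072150834, F-idea1-g14-1, farm rc 0), namespace `Summit.QuantumFields.YangMills.Theorems.GlobalSlackKernelRescale`; statements and proofs verbatim, split in three files.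

THE POINT (F-idea1-g14-1).  The displayed configuration row `bound28 : ‖B_Y(h,U)‖ ≤ cB·(r(g_k)·g_k·p(g_k))` ([Balaban1985UV3] (28) p.263, collar `R(g) = R₁r(g)` of (7)/(39))
carries the polylogarithm `rFun r₀ g = (1 + log g⁻¹)^{r₀}`, the K1a interface row of record `GlobalSlackKernelMatching.CfgSizeΦ` does not.  No letter is needed: the
chart carries its birth coupling `g_b` (G3D-01) and `jet26` is homogeneous, so RESCALING the pair `(Φ, B) ↦ (Φ ∘ (λ•), λ⁻¹•B)` with `λ_{K,b} = r(g_b) ≥ 1` turns the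
HONEST rows (with `r`, with `g`) into the rows of record, the coupling paying every polylogarithm (`g^c(1+log g⁻¹)^q ≤ M(q,c)`).

* §0 `logPowConst` `M(q,c)`, `rpow_mul_logpow_le`, `mul_logpow_le`, `min_le_rpow_mul_rpow`;
* §1 the birth coupling `gCo L γ i = √(γL^{−i})` and the collar weight `collarW = r(gCo)`: positivity, `≥ 1`, `collarW_pow_mul_gCo(_rpow)_le`;
* §2 dilations `dilateEquiv` and `iteratedFDeriv_comp_smul(_zero)`, `jet26_comp_smul` (the jet is dilation invariant);
* §3 the honest rows `KernelSizeΦg`, `FlatKernelCauchyΦg`, `CfgSizeΦr`, `CfgCauchyΦr`; the rescaled pair `rescaleΦ`/`rescaleB`; `ker_rescale`, `kerT_rescale`, norm lemmas.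
Hypothesis schemas and calculus; nothing of [Balaban1985UV3]/[King1986] is asserted.

References: T. Bałaban, CMP 102 (1985) 255–275 [Balaban1985UV3] ((7) p.257, (28) p.263, (34) p.264, (39) p.266); C. King, CMP 102 (1986) 649–677 [King1986] (Prop. 3.6
(3.55)–(3.56) p.662, Prop. 3.9 (3.71)–(3.74) p.665).
-/

noncomputable section

open scoped BigOperators
open Literature.MathematicalPhysics.QuantumFieldTheory.Balaban1983to89
open Literature.MathematicalPhysics.QuantumFieldTheory.Balaban1983to89.T3ContinuumYM3Torus
open Literature.MathematicalPhysics.QuantumFieldTheory.Balaban1983to89.T3UnitScaleTilt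
open Literature.MathematicalPhysics.QuantumFieldTheory.Balaban1983to89.T3LevelShift
open Literature.MathematicalPhysics.QuantumFieldTheory.Balaban1983to89.T3AlphaInputsAC
open Literature.MathematicalPhysics.QuantumFieldTheory.Balaban1983to89.T3AlphaPolymerSocket
open Literature.MathematicalPhysics.QuantumFieldTheory.Balaban1983to89.T3AlphaInputsACTwoRun
open Literature.MathematicalPhysics.QuantumFieldTheory.Balaban1983to89.T3AlphaInputsACTwoRunLevel
open Literature.MathematicalPhysics.QuantumFieldTheory.Balaban1985CMP102.Binders (ChartAnalyticityAsCited)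
open Summit.QuantumFields.Balaban3D.Carriers
open Summit.QuantumFields.Balaban3D.Proofs.Primitives
open Summit.QuantumFields.Balaban3D.Proofs.GroupModelLieC (lieC)
open Summit.QuantumFields.YangMills.Theorems
open Summit.QuantumFields.YangMills.Theorems.GlobalSlack (GlobalSupRateTSlack)
open Summit.QuantumFields.Balaban3D.Proofs.Representation33 (jet26)
open Summit.QuantumFields.YangMills.Theorems.GlobalSlackKernelMatching

namespace Summit.QuantumFields.YangMills.Theorems.GlobalSlackKernelRescale

/-! ## §0 Scalar lemmas: the coupling pays any polylogarithm; two-point interpolation -/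

/-- `M(q, c) := ((q+1)/c)^{q+1} e^{c-(q+1)}` — a bound for `g^c (1 + log g⁻¹)^q` on `(0, 1]` (`q ≥ 0`, `c > 0`). [folklore] -/
def logPowConst (q c : ℝ) : ℝ := ((q + 1) / c) ^ (q + 1) * Real.exp (c - (q + 1))

/-- `0 < M(q, c)`. [folklore] -/
theorem logPowConst_pos {q c : ℝ} (hq : 0 ≤ q) (hc : 0 < c) : 0 < logPowConst q c := by
  unfold logPowConst
  have h : 0 < (q + 1) / c := div_pos (by linarith) hc
  exact mul_pos (Real.rpow_pos_of_pos h _) (Real.exp_pos _)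

/-- **`g^c (1 + log g⁻¹)^q ≤ M(q, c)` on `(0, 1]`** (`q ≥ 0`, `c > 0`): the tree's tangent-line bound `B10.rpow_mul_exp_neg_le` at exponent `q + 1`.
[cite: Balaban1985UV3, (7) p.257] -/
theorem rpow_mul_logpow_le {g q c : ℝ} (hg : 0 < g) (hg1 : g ≤ 1) (hq : 0 ≤ q) (hc : 0 < c) :
    g ^ c * (1 + Real.log g⁻¹) ^ q ≤ logPowConst q c := by
  have hu := B10.log_inv_nonneg_of_le_one hg hg1
  have hgc : g ^ c = Real.exp (-(c * Real.log g⁻¹)) := by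
    rw [Real.rpow_def_of_pos hg, Real.log_inv]
    congr 1
    ring
  have h1 : (1 + Real.log g⁻¹) ^ q ≤ (1 + Real.log g⁻¹) ^ (q + 1) :=
    Real.rpow_le_rpow_of_exponent_le (by linarith) (by linarith)
  have hcore := B10.rpow_mul_exp_neg_le (q + 1) c (Real.log g⁻¹) (by linarith) hc (by linarith)
  calc g ^ c * (1 + Real.log g⁻¹) ^ q = (1 + Real.log g⁻¹) ^ q * Real.exp (-(c * Real.log g⁻¹)) := by
        rw [hgc, mul_comm]
    _ ≤ (1 + Real.log g⁻¹) ^ (q + 1) * Real.exp (-(c * Real.log g⁻¹)) :=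
        mul_le_mul_of_nonneg_right h1 (Real.exp_pos _).le
    _ ≤ logPowConst q c := hcore

/-- `g (1 + log g⁻¹)^q ≤ M(q, 1)` on `(0, 1]`. [cite: Balaban1985UV3, (7) p.257] -/
theorem mul_logpow_le {g q : ℝ} (hg : 0 < g) (hg1 : g ≤ 1) (hq : 0 ≤ q) :
    g * (1 + Real.log g⁻¹) ^ q ≤ logPowConst q 1 := by
  simpa only [Real.rpow_one] using rpow_mul_logpow_le hg hg1 hq one_pos

/-- Two-point interpolation: `min(A, B) ≤ A^{1-t} B^t` for `A, B ≥ 0`, `0 ≤ t ≤ 1`. [folklore] -/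
theorem min_le_rpow_mul_rpow {A B t : ℝ} (hA : 0 ≤ A) (hB : 0 ≤ B) (ht0 : 0 ≤ t) (ht1 : t ≤ 1) :
    min A B ≤ A ^ (1 - t) * B ^ t := by
  have h1 : (1 - t) + t ≠ 0 := by norm_num
  rcases le_total A B with hAB | hBA
  · rw [min_eq_left hAB]
    calc A = A ^ (1 - t) * A ^ t := by rw [← Real.rpow_add' hA h1, sub_add_cancel, Real.rpow_one]
      _ ≤ A ^ (1 - t) * B ^ t := mul_le_mul_of_nonneg_left (Real.rpow_le_rpow hA hAB ht0) (Real.rpow_nonneg hA _)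
  · rw [min_eq_right hBA]
    calc B = B ^ (1 - t) * B ^ t := by rw [← Real.rpow_add' hB h1, sub_add_cancel, Real.rpow_one]
      _ ≤ A ^ (1 - t) * B ^ t :=
          mul_le_mul_of_nonneg_right (Real.rpow_le_rpow hB hBA (by linarith)) (Real.rpow_nonneg hB _)

/-! ## §1 The birth coupling `g_i` and the collar weight `λ_i = r(g_i)` -/

section Coupling

variable {L : ℕ} {γ r₀ : ℝ}

/-- `g_i = √(γ L^{-i})`, the effective coupling at distance `i` from the unit scale (the `g` inside `θBal … i`). [cite: Balaban1985UV3, (5) p.256] -/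
def gCo (L : ℕ) (γ : ℝ) (i : ℕ) : ℝ := Real.sqrt (γ * ((L : ℝ)⁻¹) ^ i)

/-- `0 < g_i`. [folklore] -/
theorem gCo_pos (hL : 1 ≤ L) (hγ : 0 < γ) (i : ℕ) : 0 < gCo L γ i := by
  unfold gCo
  have hL' : (0 : ℝ) < L := by exact_mod_cast hL
  exact Real.sqrt_pos.mpr (mul_pos hγ (pow_pos (inv_pos.mpr hL') i))

/-- `g_i ≤ 1` (`0 < γ ≤ 1`, `L ≥ 1`). [cite: Balaban1985UV3, (5) p.256] -/
theorem gCo_le_one (hL : 1 ≤ L) (hγ : 0 < γ) (hγ1 : γ ≤ 1) (i : ℕ) : gCo L γ i ≤ 1 :=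
  T3Thresholds.coupling_le_one hL hγ hγ1 i

/-- The COLLAR WEIGHT `λ_i := r(g_i) = (1 + log g_i⁻¹)^{r₀}` ((7) p. 257, (39) p. 266). [cite: Balaban1985UV3, (7) p.257] -/
def collarW (L : ℕ) (γ r₀ : ℝ) (i : ℕ) : ℝ := B10.rFun r₀ (gCo L γ i)

/-- `1 ≤ λ_i` (`r₀ ≥ 0`). [folklore] -/
theorem one_le_collarW (hL : 1 ≤ L) (hγ : 0 < γ) (hγ1 : γ ≤ 1) (hr : 0 ≤ r₀) (i : ℕ) : 1 ≤ collarW L γ r₀ i := by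
  have hu := B10.log_inv_nonneg_of_le_one (gCo_pos hL hγ i) (gCo_le_one hL hγ hγ1 i)
  unfold collarW B10.rFun
  exact Real.one_le_rpow (by linarith) hr

/-- `0 < λ_i`. [folklore] -/
theorem collarW_pos (hL : 1 ≤ L) (hγ : 0 < γ) (hγ1 : γ ≤ 1) (hr : 0 ≤ r₀) (i : ℕ) : 0 < collarW L γ r₀ i :=
  lt_of_lt_of_le one_pos (one_le_collarW hL hγ hγ1 hr i)

/-- `λ_i^d ≤ (1 + log g_i⁻¹)^{6r₀}` for `d ≤ 6`. [folklore] -/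
theorem collarW_pow_le (hL : 1 ≤ L) (hγ : 0 < γ) (hγ1 : γ ≤ 1) (hr : 0 ≤ r₀) {d : ℕ} (hd : d ≤ 6) (i : ℕ) :
    collarW L γ r₀ i ^ d ≤ (1 + Real.log (gCo L γ i)⁻¹) ^ (6 * r₀) := by
  have hu := B10.log_inv_nonneg_of_le_one (gCo_pos hL hγ i) (gCo_le_one hL hγ hγ1 i)
  have hd' : (d : ℝ) ≤ 6 := by exact_mod_cast hd
  unfold collarW B10.rFun
  rw [← Real.rpow_natCast, ← Real.rpow_mul (by linarith)]
  exact Real.rpow_le_rpow_of_exponent_le (by linarith) (by nlinarith)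

/-- **The coupling pays the collar**: `λ_i^d · g_i ≤ M(6r₀, 1)` for `d ≤ 6`. [cite: Balaban1985UV3, (7) p.257] -/
theorem collarW_pow_mul_gCo_le (hL : 1 ≤ L) (hγ : 0 < γ) (hγ1 : γ ≤ 1) (hr : 0 ≤ r₀) {d : ℕ} (hd : d ≤ 6) (i : ℕ) :
    collarW L γ r₀ i ^ d * gCo L γ i ≤ logPowConst (6 * r₀) 1 := by
  have hg := gCo_pos hL hγ i
  have hg1 := gCo_le_one hL hγ hγ1 i
  calc collarW L γ r₀ i ^ d * gCo L γ i ≤ (1 + Real.log (gCo L γ i)⁻¹) ^ (6 * r₀) * gCo L γ i :=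
        mul_le_mul_of_nonneg_right (collarW_pow_le hL hγ hγ1 hr hd i) hg.le
    _ = gCo L γ i * (1 + Real.log (gCo L γ i)⁻¹) ^ (6 * r₀) := mul_comm _ _
    _ ≤ logPowConst (6 * r₀) 1 := mul_logpow_le hg hg1 (by nlinarith)

/-- **A fractional power of the coupling pays the collar**: `λ_i^d · g_i^t ≤ M(6r₀, t)` for `d ≤ 6`, `t > 0`. [cite: Balaban1985UV3, (7) p.257] -/
theorem collarW_pow_mul_gCo_rpow_le (hL : 1 ≤ L) (hγ : 0 < γ) (hγ1 : γ ≤ 1) (hr : 0 ≤ r₀) {d : ℕ} (hd : d ≤ 6) (i : ℕ)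
    {t : ℝ} (ht : 0 < t) : collarW L γ r₀ i ^ d * gCo L γ i ^ t ≤ logPowConst (6 * r₀) t := by
  have hg := gCo_pos hL hγ i
  have hg1 := gCo_le_one hL hγ hγ1 i
  calc collarW L γ r₀ i ^ d * gCo L γ i ^ t ≤ (1 + Real.log (gCo L γ i)⁻¹) ^ (6 * r₀) * gCo L γ i ^ t :=
        mul_le_mul_of_nonneg_right (collarW_pow_le hL hγ hγ1 hr hd i) (Real.rpow_nonneg hg.le _)
    _ = gCo L γ i ^ t * (1 + Real.log (gCo L γ i)⁻¹) ^ (6 * r₀) := mul_comm _ _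
    _ ≤ logPowConst (6 * r₀) t := rpow_mul_logpow_le hg hg1 (by nlinarith) ht

end Coupling

/-! ## §2 Dilations and the jet: generic calculus -/

section Dilation

variable {E G : Type*} [NormedAddCommGroup E] [NormedSpace ℂ E] [NormedAddCommGroup G] [NormedSpace ℂ G]

variable (E) in
/-- The dilation `z ↦ c • z` (`c ≠ 0`) as a continuous linear automorphism. [folklore] -/
def dilateEquiv (c : ℂ) (hc : c ≠ 0) : E ≃L[ℂ] E :=
  ContinuousLinearEquiv.equivOfInverse (c • ContinuousLinearMap.id ℂ E) (c⁻¹ • ContinuousLinearMap.id ℂ E)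
    (fun z => show c⁻¹ • (c • z) = z from inv_smul_smul₀ hc z)
    (fun z => show c • (c⁻¹ • z) = z from smul_inv_smul₀ hc z)

/-- `dilateEquiv c z = c • z`. [folklore] -/
theorem dilateEquiv_apply {c : ℂ} (hc : c ≠ 0) (z : E) : dilateEquiv E c hc z = c • z := rfl

/-- `dilateEquiv c = c • id` as a continuous linear map. [folklore] -/
theorem coe_dilateEquiv {c : ℂ} (hc : c ≠ 0) : (dilateEquiv E c hc : E →L[ℂ] E) = c • ContinuousLinearMap.id ℂ E := by
  ext z
  rfl

/-- **Chain rule for a dilation, all orders, no differentiability hypothesis**: `Dⁿ(f ∘ (c•))(x) = Dⁿf(c•x) ∘ (c•id)^{⊗n}`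
(`ContinuousLinearEquiv.iteratedFDerivWithin_comp_right` on `univ`). [folklore] -/
theorem iteratedFDeriv_comp_smul (f : E → G) {c : ℂ} (hc : c ≠ 0) (x : E) (n : ℕ) :
    iteratedFDeriv ℂ n (fun z => f (c • z)) x =
      (iteratedFDeriv ℂ n f (c • x)).compContinuousLinearMap fun _ => c • ContinuousLinearMap.id ℂ E := by
  have h := (dilateEquiv E c hc).iteratedFDerivWithin_comp_right f uniqueDiffOn_univ (Set.mem_univ (dilateEquiv E c hc x)) n
  rw [Set.preimage_univ, iteratedFDerivWithin_univ, iteratedFDerivWithin_univ, coe_dilateEquiv] at h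
  simp only [Function.comp_def, dilateEquiv_apply] at h
  exact h

/-- Pre-composition of an `n`-linear map with `c • id` in every slot is multiplication by `cⁿ`. [folklore] -/
theorem compContinuousLinearMap_smul_id {n : ℕ} (M : ContinuousMultilinearMap ℂ (fun _ : Fin n => E) G) (c : ℂ) :
    (M.compContinuousLinearMap fun _ => c • ContinuousLinearMap.id ℂ E) = c ^ n • M := by
  ext v
  simp only [ContinuousMultilinearMap.compContinuousLinearMap_apply, FunLike.coe_smul, Pi.smul_apply,
    ContinuousLinearMap.id_apply]
  rw [show (fun i => c • v i) = fun i => (fun _ : Fin n => c) i • v i from rfl, ContinuousMultilinearMap.map_smul_univ,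
    Fin.prod_const]

/-- `Dⁿ(f ∘ (c•))(0) = cⁿ • Dⁿf(0)`. [folklore] -/
theorem iteratedFDeriv_comp_smul_zero (f : E → G) {c : ℂ} (hc : c ≠ 0) (n : ℕ) :
    iteratedFDeriv ℂ n (fun z => f (c • z)) 0 = c ^ n • iteratedFDeriv ℂ n f 0 := by
  rw [iteratedFDeriv_comp_smul f hc 0 n, smul_zero, compContinuousLinearMap_smul_id]

/-- **The jet is dilation-invariant**: `jet26 (f ∘ (c•)) (c⁻¹ • B) = jet26 f B` (`c ≠ 0`; orders 2…6 are homogeneous). [cite: Balaban1985UV3, (30) p.263] -/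
theorem jet26_comp_smul (f : E → G) {c : ℂ} (hc : c ≠ 0) (B : E) :
    jet26 (fun z => f (c • z)) (c⁻¹ • B) = jet26 f B := by
  unfold jet26
  refine Finset.sum_congr rfl fun n _ => ?_
  rw [iteratedFDeriv_comp_smul_zero f hc n, smul_apply]
  congr 1
  rw [show (fun _ : Fin n => c⁻¹ • B) = fun i => (fun _ : Fin n => c⁻¹) i • (fun _ : Fin n => B) i from rfl,
    ContinuousMultilinearMap.map_smul_univ, Fin.prod_const, smul_smul, ← mul_pow, mul_inv_cancel₀ hc, one_pow, one_smul]

end Dilation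

/-! ## §3 The honest (lettered) rows the display audit located, and the rescaled pair -/

section Rows

variable {𝕍 : Type} [NormedAddCommGroup 𝕍] [NormedSpace ℂ 𝕍] {F : T3Family} {γ : ℝ}

/-- **KERNEL SIZE ROW WITH THE BIRTH COUPLING** (both runs, run-`K` tree length): `‖ker‖, ‖kerT‖ ≤ C_E·g_b·e^{−κ𝓛}`, `g_b = g_{K-b} = √(γL^{-(K-b)})` = run `K`'s displayed `S.gk b` (G3D-01 `chart`), the coupling at the chart's
birth level — the lossless reading of the displayed `chart : ChartAnalyticityAsCited (Ψ Y) ρ (C25·g_k·e^{−κ dj Y})` by Cauchy estimates (the `g_k` KEPT).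
[cite: Balaban1985UV3, Prop. 3 (34) p.264] -/
def KernelSizeΦg (D : AlphaDataT3 F γ) (Φ : ChartFam 𝕍 F) (κ C_E : ℝ) : Prop :=
  ∀ (K k b : ℕ) (Y : Set (Site (F.P K) 0)), Y ∈ D.Loc K k (D.triv K k) (1 + b) →
    ∀ d ∈ Finset.Ico 2 7,
      ‖ker Φ K b Y d‖ ≤ C_E * gCo F.L γ (K - b) * Real.exp (-κ * D.treeLen K (1 + b) Y) ∧
      ‖kerT Φ K b Y d‖ ≤ C_E * gCo F.L γ (K - b) * Real.exp (-κ * D.treeLen K (1 + b) Y)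

/-- **K1a WITH THE BIRTH COUPLING** (the `g`-carrying flat-kernel Cauchy row: kernels are activities of size `O(g_b)`, so is their two-run difference).
[cite: King1986, Prop. 3.6 (3.56) p.662] -/
def FlatKernelCauchyΦg (D : AlphaDataT3 F γ) (Φ : ChartFam 𝕍 F) (κ a C : ℝ) : Prop :=
  ∀ (K k b : ℕ) (Y : Set (Site (F.P K) 0)), Y ∈ D.Loc K k (D.triv K k) (1 + b) →
    ∀ d ∈ Finset.Ico 2 7,
      ‖kerT Φ K b Y d - ker Φ K b Y d‖ ≤
        C * gCo F.L γ (K - b) * Real.exp (-κ * D.treeLen K (1 + b) Y) * (((F.L : ℝ) ^ (1 + b))⁻¹) ^ a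

/-- **HONEST CONFIGURATION SIZE ROW** = `CfgSizeΦ` with print's collar polylogarithm `r(g_b)` of (28) at the chart's birth coupling (both runs: the matched charts
`(K, j)`, `(K+1, j+1)` have the same birth index `K-j = (K+1)-(j+1)`; at the birth level `K-n = j+1` the weight is literally `bound28`'s `rFun r₀ (S.gk j)`). [cite: Balaban1985UV3, (28) p.263, (7) p.257] -/
def CfgSizeΦr (D : AlphaDataT3 F γ) (B : CfgFam 𝕍 F) (b₀ p₀ r₀ C_s : ℝ) : Prop :=
  ∀ (K n : ℕ) (h : n ≤ K), ∀ j : ℕ, j < K - n →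
    ∀ V : GaugeField (F.P n) 0 (Matrix.specialUnitaryGroup (Fin 2) ℂ), PlaqSmall (θBal F.L γ b₀ p₀ n) V →
      ∀ Y ∈ D.Loc K (K - n) (D.triv K (K - n)) (1 + j),
        ‖B K (K - n) j Y
            (fieldShift (F.sitesPerDir_eq (m := F.m) (K := K) (j := K - n) (m' := F.m) (K' := n) (j' := 0) (by omega)) V)‖ ≤
          collarW F.L γ r₀ (K - j) * (C_s * θBal F.L γ b₀ p₀ n * (((F.L : ℝ) ^ (K - n - 1 - j))⁻¹) ^ 2) ∧
        ‖(fun c => B (K + 1) (K + 1 - n) (j + 1) (refineSet F K Y)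
            (fieldShift (F.sitesPerDir_eq (m := F.m) (K := K + 1) (j := K + 1 - n) (m' := F.m) (K' := n) (j' := 0) (by omega)) V)
            (matchBond F K j c))‖ ≤
          collarW F.L γ r₀ (K - j) * (C_s * θBal F.L γ b₀ p₀ n * (((F.L : ℝ) ^ (K - n - 1 - j))⁻¹) ^ 2)

/-- **HONEST CONFIGURATION CAUCHY ROW** = `CfgCauchyΦ` with the collar polylogarithm `r(g_b)`. [cite: King1986, Prop. 3.9 (3.71) p.665] -/
def CfgCauchyΦr (D : AlphaDataT3 F γ) (B : CfgFam 𝕍 F) (b₀ p₀ r₀ a C_B : ℝ) (ℓ : ℕ → ℝ) : Prop :=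
  ∀ (K n : ℕ) (h : n ≤ K), ∀ j : ℕ, j < K - n →
    ∀ V : GaugeField (F.P n) 0 (Matrix.specialUnitaryGroup (Fin 2) ℂ), PlaqSmall (θBal F.L γ b₀ p₀ n) V →
      ∀ Y ∈ D.Loc K (K - n) (D.triv K (K - n)) (1 + j),
        ‖(fun c => B (K + 1) (K + 1 - n) (j + 1) (refineSet F K Y)
              (fieldShift (F.sitesPerDir_eq (m := F.m) (K := K + 1) (j := K + 1 - n) (m' := F.m) (K' := n) (j' := 0) (by omega)) V)
              (matchBond F K j c)) -
            B K (K - n) j Y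
              (fieldShift (F.sitesPerDir_eq (m := F.m) (K := K) (j := K - n) (m' := F.m) (K' := n) (j' := 0) (by omega)) V)‖ ≤
          collarW F.L γ r₀ (K - j) *
            (C_B * θBal F.L γ b₀ p₀ n * (((F.L : ℝ) ^ (K - n - 1 - j))⁻¹) ^ 2 * (ℓ n * (((F.L : ℝ) ^ (1 + j))⁻¹) ^ a))

/-- THE RESCALED CHART FAMILY `Φ̃ K b Y z := Φ K b Y (λ_{K-b} • z)` (weights `w` by birth index). [cite: Balaban1985UV3, (30) p.263] -/
def rescaleΦ (w : ℕ → ℝ) (Φ : ChartFam 𝕍 F) : ChartFam 𝕍 F :=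
  fun K b Y z => Φ K b Y (((w (K - b) : ℝ) : ℂ) • z)

/-- THE RESCALED CONFIGURATION FAMILY `B̃ K k b Y W := λ_{K-b}⁻¹ • B K k b Y W`. [cite: Balaban1985UV3, (27)-(28) p.263] -/
def rescaleB (w : ℕ → ℝ) (B : CfgFam 𝕍 F) : CfgFam 𝕍 F :=
  fun K k b Y W => ((w (K - b) : ℝ) : ℂ)⁻¹ • B K k b Y W

/-- `ker Φ̃ K b Y d = λ^d • ker Φ K b Y d`. [folklore] -/
theorem ker_rescale (w : ℕ → ℝ) (hw : ∀ i, w i ≠ 0) (Φ : ChartFam 𝕍 F) (K b : ℕ) (Y : Set (Site (F.P K) 0)) (d : ℕ) :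
    ker (rescaleΦ w Φ) K b Y d = (((w (K - b) : ℝ) : ℂ)) ^ d • ker Φ K b Y d := by
  show iteratedFDeriv ℂ d (fun z => Φ K b Y (((w (K - b) : ℝ) : ℂ) • z)) 0 = _
  exact iteratedFDeriv_comp_smul_zero (Φ K b Y) (Complex.ofReal_ne_zero.mpr (hw _)) d

/-- `kerT Φ̃ K b Y d = λ^d • kerT Φ K b Y d` (the matched chart `(K+1, b+1)` has the same birth height). [folklore] -/
theorem kerT_rescale (w : ℕ → ℝ) (hw : ∀ i, w i ≠ 0) (Φ : ChartFam 𝕍 F) (K b : ℕ) (Y : Set (Site (F.P K) 0)) (d : ℕ) :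
    kerT (rescaleΦ w Φ) K b Y d = (((w (K - b) : ℝ) : ℂ)) ^ d • kerT Φ K b Y d := by
  have hidx : K + 1 - (b + 1) = K - b := by omega
  unfold kerT
  rw [ker_rescale w hw Φ (K + 1) (b + 1), hidx]
  ext v
  simp only [ContinuousMultilinearMap.compContinuousLinearMap_apply, smul_apply]

/-- A scalar pulls out of the sup norm of a pulled-back configuration. [folklore] -/
theorem norm_smul_pullback {K j : ℕ} (c : ℂ) (x' : PBond (F.P (K + 1)) (j + 1) → 𝕍) :
    ‖(fun b => c • x' (matchBond F K j b))‖ = ‖c‖ * ‖(fun b => x' (matchBond F K j b))‖ := by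
  rw [← norm_smul]
  rfl

/-- A scalar pulls out of the sup norm of a difference of (pulled-back) configurations. [folklore] -/
theorem norm_smul_pullback_sub {K j : ℕ} (c : ℂ) (x' : PBond (F.P (K + 1)) (j + 1) → 𝕍) (x : PBond (F.P K) j → 𝕍) :
    ‖(fun b => c • x' (matchBond F K j b)) - c • x‖ = ‖c‖ * ‖(fun b => x' (matchBond F K j b)) - x‖ := by
  rw [← norm_smul, smul_sub]
  rfl

/-- `c • x − c • y = c • (x − y)` for flat kernels (explicit instance path for `rw`). [folklore] -/
theorem smul_sub_rescale {K b d : ℕ} (c : ℂ) (x y : ContinuousMultilinearMap ℂ (fun _ : Fin d => PBond (F.P K) b → 𝕍) ℂ) :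
    c • (x - y) = c • x - c • y :=
  smul_sub c x y

end Rows

end Summit.QuantumFields.YangMills.Theorems.GlobalSlackKernelRescale

end
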